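import Summits.AtomisticToContinuum.BoseEinsteinCondensation.Theorems.FibreConductance.Negative.DensityModulationTestFunction

/-!
# Crux `FibreConductance` (stmt-AtomisticToContinuum-9480), line `parseval-shell-bootstrap` —
negative lemma on the stub `stub_densityFlattening`: (H1) cannot be relaxed to near-minimality

Refuter (drefute) support file.  `DensityFlattening` (stub 5 of `Lines/parseval-shell-bootstrap.lean`)
asserts, for EXACT zero-free minimisers `Φ` (hypothesis (H1)), a fibre flow `J_d` driving the
conditional density `ψ² = |Φ|²/W` of particle `0` to `L⁻³` with bath-averaged SECOND moment of the
fibre cost `D = ∫_cell |J_d|²/ψ²` bounded by `E_W[D²] ≤ K L²`; by Cauchy–Schwarz in the bath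
(`E_W 1 = 1`) this implies the FIRST-moment bound `E_W[D] = ∫_{cellN}|J_d|² W/ψ² ≤ √K · L`, i.e. a
bound `fibreCost ≤ K'L` on the crux-type Thomson cost of `J_d` for the density charge `ψ² - L⁻³`.

Here: that first-moment statement with (H1) relaxed to `periodicEnergy v Φ ≤ E₀ + δ` — the slack
`δ > 0` chosen by the claimant together with `ρ₀, K, N₀` (`DensityFlatteningCostNearMinimiser`) — is
FALSE, already at `v = 0`; hence so is the near-minimiser relaxation of the stub itself (through the
displayed Cauchy–Schwarz step, left informal).  Witness: the SOFTEST landscape — the real positive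
product state `Φ = g^{⊗N}` of `CosProductState.lean` with the LOWEST mode, `g = a + 2b cos(2πy₀/L)`,
`a = 31s/33`, `b = 8s/33`, `s² = L⁻³`; `N` fixed, `L → ∞` (the stub has no window, so the density may
tend to `0`): its energy `≤ (1024π²/1089)·N/L² → 0` makes it `δ`-near-minimal, `ψ = g(x₀)` exactly,
and Thomson duality (`norm_pairing_sq_le`) with the test function `η = e₁(x₀) ∏_{j≠0} g(xⱼ)²`
(pairing `2abL³`, dual energy `≤ 4π²(a+2b)²L`) forces EVERY admissible flow to cost
`≥ a²b²L⁵/(π²(a+2b)²) = (248/1551)²L²/π² ≈ L²/386`, which beats `K·L` for `L > 40π²K`.  Reading: an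
`O(1)` relative modulation of the conditional density at scale `L` costs `≍ L²` to flatten but only
`O(N/L²)` in energy, so (H1) enters any proof of stub 5 through the exact ground-state structure, not
through energy comparison; and the normalisation `E_W[D²] ≤ K L²` sits exactly at the threshold of
such modulations.
-/

noncomputable section

namespace Summit.AtomisticToContinuum.BoseEinsteinCondensation.Theorems.FibreConductance.Negative

open MeasureTheory Literature.MathematicalPhysics.QuantumManyBody.BoseGas
open Summit.AtomisticToContinuum.BoseEinsteinCondensation.Theorems.GaussianDominationCan.Negative
open scoped ENNReal NNReal ComplexConjugate

variable {m : ℕ} {L a b : ℝ}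

/-! ### The statement and the refutation -/

/-- Stub 5 `DensityFlattening` of `Lines/parseval-shell-bootstrap.lean` in FIRST-MOMENT form — the
conclusion `E_W[D²] ≤ K L²` (`∫_{cellN} W·D² ≤ K L⁵`) replaced by its Cauchy–Schwarz consequence
`E_W[D] = ∫_{cellN} |J|² W/ψ² ≤ K L` on the Thomson cost (`fibreCost`, `IsFibreFlow`, `fibrePsi` of
`FibreVocabulary.lean` are the skeleton's `fibreCost`/`HasWeakDiv`/`fibrePsi` up to unfolding) — and
with the exact-minimiser hypothesis (H1) relaxed to `periodicEnergy v Φ ≤ E₀ + δ`, the slack `δ > 0`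
at the disposal of the claimant together with `ρ₀, K, N₀`.  No window, no `M` (as in the stub). -/
def DensityFlatteningCostNearMinimiser : Prop :=
  ∀ v : ℝ → ℝ≥0∞, IsRepulsiveFiniteRange v → (∃ B : ℝ, ∀ r, v r ≤ ENNReal.ofReal B) →
    ∃ ρ₀ K : ℝ, 0 < ρ₀ ∧ 0 < K ∧ ∃ N₀ : ℕ, ∃ δ : ℝ≥0∞, 0 < δ ∧ ∀ m : ℕ, N₀ ≤ m + 1 →
      ∀ L : ℝ, 0 < L → ((m + 1 : ℕ) : ℝ) ≤ ρ₀ * L ^ 3 →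
        ∀ Φ : PeriodicTrialState (m + 1) L,
          periodicEnergy v Φ ≤ periodicGroundStateEnergy v (m + 1) L + δ → (∀ X, Φ.ψ X ≠ 0) →
            ∃ J : Config (m + 1) → (Fin 3 → ℂ),
              IsFibreFlow m L (fun X => (((fibrePsi L Φ.ψ X ^ 2 - (L ^ 3)⁻¹ : ℝ)) : ℂ)) J ∧
                fibreCost L Φ.ψ J ≤ ENNReal.ofReal (K * L)

/-- **(H1) of `stub_densityFlattening` cannot be relaxed to `δ`-near-minimality** (first-moment
form; the stub's second-moment conclusion is stronger by Cauchy–Schwarz in the bath).  Witness: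
`v = 0`, `Φ = g^{⊗N}` with the lowest mode `g = a + 2b cos(2πy₀/L)`, `N` fixed, `L` large; duality
with `η = e₁(x₀)∏_{j≠0}g(xⱼ)²`. [folklore] -/
theorem not_densityFlatteningCostNearMinimiser : ¬ DensityFlatteningCostNearMinimiser := by
  intro h
  obtain ⟨ρ₀, K, hρ₀, hK, N₀, δ, hδ, h⟩ := h 0 isRepulsiveFiniteRange_zero ⟨0, fun r => by simp⟩
  obtain ⟨m, hmN₀, -⟩ := exists_large N₀ 0
  set N : ℝ := ((m + 1 : ℕ) : ℝ) with hN
  have hN1 : (1 : ℝ) ≤ N := by rw [hN]; exact_mod_cast Nat.succ_le_succ (Nat.zero_le m)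
  have hNpos : 0 < N := by linarith
  -- the side `L`
  set E₁ : ℝ := 1024 * Real.pi ^ 2 / 1089 * N / δ.toReal with hE₁
  have hE₁nn : 0 ≤ E₁ := div_nonneg (by positivity) ENNReal.toReal_nonneg
  clear_value E₁
  set L : ℝ := 1 + N / ρ₀ + 40 * Real.pi ^ 2 * K + E₁ with hL
  have hNρ : 0 ≤ N / ρ₀ := by positivity
  have hπK : 0 < 40 * Real.pi ^ 2 * K := by positivity
  have hL1 : 1 ≤ L := by linarith
  have hLpos : 0 < L := by linarith
  have hLρ : N / ρ₀ ≤ L := by linarith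
  have hLK : 40 * Real.pi ^ 2 * K < L := by linarith
  have hLE : E₁ ≤ L := by linarith
  clear_value L
  have hL3 : 0 < L ^ 3 := by positivity
  -- density
  have hdens : N ≤ ρ₀ * L ^ 3 := by
    have h1 : N ≤ ρ₀ * L := by rw [div_le_iff₀' hρ₀] at hLρ; exact hLρ
    have h2 : ρ₀ * L ≤ ρ₀ * L ^ 3 := by
      apply mul_le_mul_of_nonneg_left _ hρ₀.le
      nlinarith [hL1, sq_nonneg L]
    linarith
  -- the state `g^{⊗N}`, lowest mode `n = e₀`
  set s : ℝ := (Real.sqrt (L ^ 3))⁻¹ with hs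
  have hspos : 0 < s := by positivity
  have hs2 : s ^ 2 * L ^ 3 = 1 := by
    rw [hs, inv_pow, Real.sq_sqrt hL3.le, inv_mul_cancel₀ hL3.ne']
  set a : ℝ := 31 / 33 * s with ha
  set b : ℝ := 8 / 33 * s with hb
  have hab : (a ^ 2 + 2 * b ^ 2) * L ^ 3 = 1 := by
    rw [show a ^ 2 + 2 * b ^ 2 = s ^ 2 by rw [ha, hb]; ring, hs2]
  have h2b : 2 * b < a := by rw [ha, hb]; linarith
  have hb0 : 0 ≤ b := by positivity
  have hapos : 0 < a := by positivity
  have hbL : b ^ 2 * L ^ 3 = 64 / 1089 := by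
    rw [hb]; linear_combination (64 / 1089 : ℝ) * hs2
  have habL : a * b * L ^ 3 = 248 / 1089 := by
    rw [ha, hb]; linear_combination (248 / 1089 : ℝ) * hs2
  have ha2bL : (a + 2 * b) ^ 2 * L ^ 3 = (47 / 33) ^ 2 := by
    rw [ha, hb]; linear_combination ((47 / 33) ^ 2 : ℝ) * hs2
  clear_value s a b
  -- near-minimality: energy `≤ (1024π²/1089) N/L² ≤ δ`
  have hE : periodicEnergy 0 (cosState m hLpos e0_ne_zero a b hab) ≤
      periodicGroundStateEnergy 0 (m + 1) L + δ := by
    by_cases hδtop : δ = ⊤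
    · rw [hδtop, add_top]; exact le_top
    have hδr : 0 < δ.toReal := ENNReal.toReal_pos hδ.ne' hδtop
    refine (periodicEnergy_cosState_le hLpos e0_ne_zero hab).trans ?_
    refine (ENNReal.ofReal_le_of_le_toReal ?_).trans le_add_self
    rw [hbL, nsq_e0]
    have h1 : 1024 * Real.pi ^ 2 / 1089 * N ≤ δ.toReal * L := by
      rw [hE₁, div_le_iff₀ hδr] at hLE; linarith
    have h2 : N * (4 * (64 / 1089) * (4 * Real.pi ^ 2 * 1 / L ^ 2)) =
        (1024 * Real.pi ^ 2 / 1089 * N) / L ^ 2 := by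
      field_simp; ring
    rw [h2, div_le_iff₀ (by positivity)]
    have h3 : δ.toReal * L ≤ δ.toReal * L ^ 2 := by
      apply mul_le_mul_of_nonneg_left _ hδr.le
      nlinarith [hL1]
    linarith
  have hz : ∀ X, (cosState m hLpos e0_ne_zero a b hab).ψ X ≠ 0 := fun X => cosFun_ne_zero h2b hb0 X
  obtain ⟨J, hJ, hcost⟩ := h m hmN₀ L hLpos hdens (cosState m hLpos e0_ne_zero a b hab) hE hz
  -- the charge and the cost in terms of the profile
  have hφ : ∀ y, 0 < cosRe L e0 a b y := cosRe_pos h2b hb0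
  have hn1 := integral_sq_cosRe hLpos hab
  have hψ : (fun X => (((fibrePsi L (cosState m hLpos e0_ne_zero a b hab).ψ X ^ 2 - (L ^ 3)⁻¹ : ℝ)) : ℂ)) =
      fun X => (((cosRe L e0 a b (X 0) ^ 2 - (L ^ 3)⁻¹ : ℝ)) : ℂ) := by
    funext X
    rw [show (cosState m hLpos e0_ne_zero a b hab).ψ = cosFun m L e0 a b from rfl,
      fibrePsi_cosFun hLpos hab h2b hb0]
  rw [hψ] at hJ
  have hcost' : ∫⁻ X in cellN (m + 1) L, ENNReal.ofReal ((∑ l : Fin 3, ‖J X l‖ ^ 2) *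
      (bathProd (cosRe L e0 a b) X / cosRe L e0 a b (X 0) ^ 2)) ≤ ENNReal.ofReal (K * L) := by
    rw [show (cosState m hLpos e0_ne_zero a b hab).ψ = cosFun m L e0 a b from rfl, cosFun_eq_realProd,
      fibreCost_realProd hφ hn1] at hcost
    exact hcost
  -- Thomson duality with `η = e₁(x₀) ∏_{j≠0} g²`
  have hw : ∀ X : Config (m + 1), 0 < bathProd (cosRe L e0 a b) X / cosRe L e0 a b (X 0) ^ 2 :=
    fun X => div_pos (bathProd_pos hφ X) (pow_pos (hφ _) 2)
  have hwm : Measurable fun X : Config (m + 1) =>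
      bathProd (cosRe L e0 a b) X / cosRe L e0 a b (X 0) ^ 2 := by
    refine Measurable.div ?_ ?_
    · exact (continuous_finsetProd _ fun j _ =>
        ((continuous_cosRe L e0 a b).comp (continuous_apply j)).pow 2).measurable
    · exact (((continuous_cosRe L e0 a b).comp (continuous_apply 0)).pow 2).measurable
  have hD0 : 0 ≤ 4 * Real.pi ^ 2 * (a + 2 * b) ^ 2 * L := by positivity
  have key := norm_pairing_sq_le hJ contDiff_etaD (etaD_periodic hLpos.ne') hw hwm
    (by positivity : 0 ≤ K * L) hD0 hcost' (lintegral_dual_etaD_le hLpos hab h2b hb0)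
  rw [pairing_etaD hLpos hab] at key
  have hnorm : ‖(L : ℂ) ^ 3 * (2 * a * b)‖ = L ^ 3 * (2 * a * b) := by
    rw [show (L : ℂ) ^ 3 * (2 * a * b) = ((L ^ 3 * (2 * a * b) : ℝ) : ℂ) by push_cast; ring,
      Complex.norm_real, Real.norm_of_nonneg (by positivity)]
  rw [hnorm] at key
  -- numbers: `4(248/1089)² L ≤ 4π²K(47/33)²`, against `L > 40π²K`
  have e1 : (L ^ 3 * (2 * a * b)) ^ 2 = 4 * (248 / 1089) ^ 2 := by
    rw [show L ^ 3 * (2 * a * b) = 2 * (a * b * L ^ 3) by ring, habL]; ring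
  have key2 := mul_le_mul_of_nonneg_right key hLpos.le
  rw [e1, show K * L * (4 * Real.pi ^ 2 * (a + 2 * b) ^ 2 * L) * L =
      4 * Real.pi ^ 2 * K * ((a + 2 * b) ^ 2 * L ^ 3) by ring, ha2bL] at key2
  have h6 : 4 * (248 / 1089 : ℝ) ^ 2 * (40 * Real.pi ^ 2 * K) < 4 * (248 / 1089) ^ 2 * L :=
    mul_lt_mul_of_pos_left hLK (by positivity)
  have hP : 0 < Real.pi ^ 2 * K := by positivity
  have h8 : (160 * (248 / 1089) ^ 2) * (Real.pi ^ 2 * K) < (4 * (47 / 33) ^ 2) * (Real.pi ^ 2 * K) := by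
    nlinarith [key2, h6]
  have h9 := lt_of_mul_lt_mul_right h8 hP.le
  norm_num at h9

end Summit.AtomisticToContinuum.BoseEinsteinCondensation.Theorems.FibreConductance.Negative

end
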